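import Literature.NumberTheory.GaloisRepresentations.LAdicCharacterUnramifiedAEProofs
import Mathlib.NumberTheory.Padics.PadicIntegers
import Mathlib.Analysis.Normed.Field.Ultra
import Mathlib.Algebra.Ring.GeomSum
import HarnessLib

/-!
# Powers of a principal unit in an ultrametric field: `‖u^a − 1‖ = ‖u − 1‖` for `p ∤ a`, and `u^{a_m} → 1` forces `a_m → 0` in
# `ℤ_p` when `u` is not `p`-power torsion (exponent separation; proofs only)

Topic `NumberTheory/GaloisRepresentations` (`p`-adic local analysis; namespace `Literature.NumberTheory.GaloisRepresentations.PadicUnitPowers`).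
THEOREMS ONLY (no definition, no named fact; D-0026). For an ultrametric normed field `L` in which the natural numbers prime to `p`
have norm `1` and all natural numbers norm `≤ 1` (any `L ⊇ ℚ_p` with the `p`-adic norm: `ℚ̄_p`, `ℂ_p`, finite extensions):

* `norm_pow_sub_one_le` — `‖w^n − 1‖ ≤ ‖w − 1‖` for `‖w‖ ≤ 1` (`w^n − 1 = (w − 1)(1 + w + ⋯ + w^{n−1})`);
* `norm_pow_sub_one_eq_of_not_dvd` — **`‖u^a − 1‖ = ‖u − 1‖` for a principal unit `u` (`‖u − 1‖ < 1`) and `p ∤ a`**: the geometric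
  sum `1 + u + ⋯ + u^{a−1} ≡ a (mod 𝔪)` is a unit;
* `tendsto_natCast_padicInt_zero_of_tendsto_pow` — **EXPONENT SEPARATION**: if `‖u − 1‖ < 1`, `u^{p^e} ≠ 1` for all `e`, and
  `u^{a_m} → 1` for natural numbers `a_m`, then `(a_m : ℤ_p) → 0` (for each `e`, eventually `p^e ∣ a_m`: otherwise
  `‖u^{a_m} − 1‖ = ‖u^{p^{v(a_m)}} − 1‖ ≥ ‖u^{p^e} − 1‖ > 0`);
* `tendsto_natCast_padicInt_zero_of_tendsto_pow_of_norm_pow_sub_one_lt` — the same for a unit `α` with `‖α^N − 1‖ < 1` for some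
  `N ≥ 1` and `α` of infinite order (apply the above to `u = α^N`).

Use (cell `bsd-stepL`, crux 25505, stub (FIX), step (4')): the hypothesis `hα` of
`IsNonarchimedeanLocalField.toAdd_eq_zero_of_unramified_of_apply_eq_one` for `α = α_p`, the unit root (`|ι α_p| = p^{(k−1)/2}` so
`α_p` has infinite order [Deligne]).

References: [SerreLocalFields1979] Ch. IV §2 Prop. 6, §3 (the filtration `U^n` and `(1+x)^a`); [Washington1997] §5.1 (`p`-adic units).
-/

noncomputable section

open Filter Topology Finset

namespace Literature.NumberTheory.GaloisRepresentations.PadicUnitPowers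

variable {L : Type*} [NormedField L] [IsUltrametricDist L]

/-- `‖w^n − 1‖ ≤ ‖w − 1‖` for `‖w‖ ≤ 1` (`w^n − 1 = (∑_{i<n} w^i)(w − 1)` and the geometric sum has norm `≤ 1`).
[cite: SerreLocalFields1979, Ch. IV §2 Prop. 6] -/
theorem norm_pow_sub_one_le {w : L} (hw : ‖w‖ ≤ 1) (n : ℕ) : ‖w ^ n - 1‖ ≤ ‖w - 1‖ := by
  have hgeom : (∑ i ∈ range n, w ^ i) * (w - 1) = w ^ n - 1 := geom_sum_mul w n
  have hsum : ‖∑ i ∈ range n, w ^ i‖ ≤ 1 := by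
    refine IsUltrametricDist.norm_sum_le_of_forall_le_of_nonneg zero_le_one fun i _ ↦ ?_
    rw [norm_pow]
    exact pow_le_one₀ (norm_nonneg w) hw
  rw [← hgeom, norm_mul]
  calc ‖∑ i ∈ range n, w ^ i‖ * ‖w - 1‖ ≤ 1 * ‖w - 1‖ :=
        mul_le_mul_of_nonneg_right hsum (norm_nonneg _)
    _ = ‖w - 1‖ := one_mul _

/-- **`‖u^a − 1‖ = ‖u − 1‖` for a principal unit `u` and `p ∤ a`**, in an ultrametric field where naturals prime to `p` have norm `1`:
`u^a − 1 = (u − 1)·s` with `s = ∑_{i<a} u^i = a + ∑ (u^i − 1)`, `‖u^i − 1‖ ≤ ‖u − 1‖ < 1 = ‖a‖`, so `‖s‖ = 1`.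
[cite: SerreLocalFields1979, Ch. IV §2 Prop. 6 and §3 Prop. 9] -/
theorem norm_pow_sub_one_eq_of_not_dvd {p : ℕ} (hnat : ∀ n : ℕ, ¬ p ∣ n → ‖(n : L)‖ = 1) {u : L}
    (hu : ‖u - 1‖ < 1) {a : ℕ} (ha : ¬ p ∣ a) : ‖u ^ a - 1‖ = ‖u - 1‖ := by
  have hu1 : ‖u‖ = 1 := norm_eq_one_of_norm_sub_one_lt_one hu
  have hgeom : (∑ i ∈ range a, u ^ i) * (u - 1) = u ^ a - 1 := geom_sum_mul u a
  -- `s = a + ∑ (u^i - 1)` has norm `1`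
  have hdec : ∑ i ∈ range a, u ^ i = (a : L) + ∑ i ∈ range a, (u ^ i - 1) := by
    rw [Finset.sum_sub_distrib, Finset.sum_const, card_range, nsmul_eq_mul, mul_one]; ring
  have hsmall : ‖∑ i ∈ range a, (u ^ i - 1)‖ < 1 := by
    refine lt_of_le_of_lt (IsUltrametricDist.norm_sum_le_of_forall_le_of_nonneg (norm_nonneg (u - 1))
      fun i _ ↦ norm_pow_sub_one_le hu1.le i) hu
  have hs : ‖∑ i ∈ range a, u ^ i‖ = 1 := by
    rw [hdec]
    have hne : ‖(a : L)‖ ≠ ‖∑ i ∈ range a, (u ^ i - 1)‖ := by rw [hnat a ha]; exact hsmall.ne'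
    rw [IsUltrametricDist.norm_add_eq_max_of_norm_ne_norm hne, hnat a ha, max_eq_left hsmall.le]
  rw [← hgeom, norm_mul, hs, one_mul]

/-- **EXPONENT SEPARATION for a principal unit of infinite `p`-power order**: if `‖u − 1‖ < 1`, `u^{p^e} ≠ 1` for every `e`, and
`u^{a_m} → 1` for a sequence of natural numbers, then `a_m → 0` in `ℤ_p` (each `p^e` eventually divides `a_m`).
[cite: SerreLocalFields1979, Ch. IV §3 Prop. 9 (structure of the principal units)] -/
theorem tendsto_natCast_padicInt_zero_of_tendsto_pow {p : ℕ} [Fact p.Prime]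
    (hnat : ∀ n : ℕ, ¬ p ∣ n → ‖(n : L)‖ = 1) {u : L} (hu : ‖u - 1‖ < 1) (hne : ∀ e : ℕ, u ^ (p ^ e) ≠ 1)
    {a : ℕ → ℕ} (hlim : Tendsto (fun m ↦ u ^ (a m)) atTop (𝓝 1)) :
    Tendsto (fun m ↦ ((a m : ℕ) : ℤ_[p])) atTop (𝓝 0) := by
  have hp : p.Prime := Fact.out
  have hu1 : ‖u‖ = 1 := norm_eq_one_of_norm_sub_one_lt_one hu
  -- eventually `p^e ∣ a m`, for every `e`
  have hdiv : ∀ e : ℕ, ∀ᶠ m in atTop, p ^ e ∣ a m := by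
    intro e
    have hce : 0 < ‖u ^ (p ^ e) - 1‖ := norm_pos_iff.mpr (sub_ne_zero.mpr (hne e))
    have hev : ∀ᶠ m in atTop, ‖u ^ (a m) - 1‖ < ‖u ^ (p ^ e) - 1‖ := by
      have h := (tendsto_iff_norm_sub_tendsto_zero.mp hlim)
      exact (h.eventually (gt_mem_nhds hce))
    filter_upwards [hev] with m hm
    by_contra hnd
    have ham : a m ≠ 0 := fun h0 ↦ hnd (h0 ▸ dvd_zero _)
    obtain ⟨e', b, hb, hab⟩ := Nat.exists_eq_pow_mul_and_not_dvd ham p hp.ne_one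
    -- `e' < e`
    have he' : e' < e := by
      by_contra hle
      exact hnd (hab ▸ (pow_dvd_pow p (not_lt.mp hle)).mul_right b)
    -- `‖u^{a m} − 1‖ = ‖u^{p^{e'}} − 1‖ ≥ ‖u^{p^e} − 1‖`
    have hu' : ‖u ^ (p ^ e') - 1‖ < 1 := lt_of_le_of_lt (norm_pow_sub_one_le hu1.le _) hu
    have heq : ‖u ^ (a m) - 1‖ = ‖u ^ (p ^ e') - 1‖ := by
      rw [hab, pow_mul]
      exact norm_pow_sub_one_eq_of_not_dvd hnat hu' hb
    have hge : ‖u ^ (p ^ e) - 1‖ ≤ ‖u ^ (p ^ e') - 1‖ := by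
      obtain ⟨d, hd⟩ := Nat.exists_eq_add_of_le he'.le
      have : u ^ (p ^ e) = (u ^ (p ^ e')) ^ (p ^ d) := by rw [← pow_mul, ← pow_add, hd]
      rw [this]
      exact norm_pow_sub_one_le (by rw [norm_pow, hu1, one_pow]) _
    exact absurd (heq ▸ hm) (not_lt.mpr hge)
  -- hence `‖(a m : ℤ_p)‖ ≤ p^{-e}` eventually, for every `e`
  rw [Metric.tendsto_atTop]
  intro ε hε
  obtain ⟨e, he⟩ := PadicInt.exists_pow_neg_lt p hε
  obtain ⟨M, hM⟩ := (hdiv e).exists_forall_of_atTop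
  refine ⟨M, fun m hm ↦ ?_⟩
  rw [dist_zero_right]
  refine lt_of_le_of_lt ?_ he
  rw [PadicInt.norm_le_pow_iff_mem_span_pow, Ideal.mem_span_singleton]
  obtain ⟨c, hc⟩ := hM m hm
  exact ⟨c, by rw [hc, Nat.cast_mul, Nat.cast_pow]⟩

/-- **EXPONENT SEPARATION for a unit of infinite order**: if `‖α^N − 1‖ < 1` for some `N ≥ 1` (any unit of a `p`-adic field: take
`N = #k(𝒪)ˣ`), `α^n ≠ 1` for all `n ≥ 1`, and `α^{a_m} → 1`, then `a_m → 0` in `ℤ_p`. [cite: SerreLocalFields1979, Ch. IV §3 Prop. 9] -/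
theorem tendsto_natCast_padicInt_zero_of_tendsto_pow_of_norm_pow_sub_one_lt {p : ℕ} [Fact p.Prime]
    (hnat : ∀ n : ℕ, ¬ p ∣ n → ‖(n : L)‖ = 1) {α : L} {N : ℕ} (hN : 0 < N) (hαN : ‖α ^ N - 1‖ < 1)
    (htors : ∀ n : ℕ, 0 < n → α ^ n ≠ 1)
    {a : ℕ → ℕ} (hlim : Tendsto (fun m ↦ α ^ (a m)) atTop (𝓝 1)) :
    Tendsto (fun m ↦ ((a m : ℕ) : ℤ_[p])) atTop (𝓝 0) := by
  have hp : p.Prime := Fact.out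
  refine tendsto_natCast_padicInt_zero_of_tendsto_pow hnat hαN (fun e h ↦ ?_) ?_
  · rw [← pow_mul] at h
    exact htors _ (Nat.mul_pos hN (pow_pos hp.pos e)) h
  · have : (fun m ↦ (α ^ N) ^ (a m)) = fun m ↦ (α ^ (a m)) ^ N := by
      funext m; rw [← pow_mul, ← pow_mul, mul_comm]
    rw [this]
    have h := hlim.pow N
    rwa [one_pow] at h

end Literature.NumberTheory.GaloisRepresentations.PadicUnitPowers

end
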